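/-
Origin: expansion seat `planner-pub-hodgecm-pv08-g2-0`, handover 2026-08-18 (`HOME/pub-hodgecm-pv08-g2/lean/Pv08g2/S5Conservative.lean`, md5 6e83fa6b, 270 lines);
landed by the gen-6 packager in gate run 22 as `HodgeCM/PerL34/S5Conservative.lean` (import ^import Pv[0-9]+\.→import HodgeCM.PerL34. ×1).
-/
import Summits.HodgeConjecture.HodgeCM.PerL34.SeesawDictionary

/-!
# Seam S5, `N19w` half — the bridge record is CONSERVATIVE over the node leaf (kernel boundary witness)

Unit `pub-hodgecm-pv08-g2` (DAG-node prover #08, gen 2 = the N19 node owner), 2026-08-18.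
WIP import `Pv11.SeesawDictionary` = pv11's handed-over `SeesawDictionary.lean` (md5 f942ea4b, vendored
byte-identically); on landing the packager rewrites it to `HodgeCM.PerL34.SeesawDictionary`.

pv11's record `SeesawDictionary.SeesawBridge T V c D k l` (LEMMAS.md v5 §9 seam S5, (12)-half) packages a
lattice shell `ThetaSeesawData` with its N17 hypotheses and two DICTIONARY fields `Λ_wedge`, `ϑ_period`, and
pv11 PROVED `N19w_genIdentity_of_bridge : SeesawBridge … → N19w_genIdentity …` (kernel join = the landed
`SeesawWedge.genIdentity_core`).  This file proves the CONVERSE: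

* `bridge_of_genIdentity : N19w_genIdentity T V c D k l → SeesawBridge T V c D k l` (an explicit, admittedly
  degenerate, instance: a one-point "torus", Dirac measures, Schwartz "functions" = functions on `L²([G_U])`
  itself, and a choice-defined realisation map `toHG` decoding indicator functions), hence
* `nonempty_bridge_iff : Nonempty (SeesawBridge T V c D k l) ↔ N19w_genIdentity T V c D k l`, and at the level
  of the realisation input, `bridges_iff_genIdentity`.

READING (for referees 2/3, the carver's binder census and the writer).  The equivalence says the S5
(12)-record carries EXACTLY the logical strength of the model-level leaf `N19w_genIdentity` — no more (so
consuming `hbr : ∀ good ctx, Nonempty (SeesawBridge …)` in `AssemblyDict.perL_of_dictLeaves` instead of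
`h19w` adds NO hidden hypothesis and NO vacuity risk beyond the leaf itself) and no less (so the record, AS A
TYPE, certifies nothing about print: a model in which the leaf holds admits the junk instance below).  Its
evidentiary value is therefore entirely in the LABELS of its fields under the INTENDED instantiation (adelic
Schwartz spaces, the Weil representation `ω_{W,μ_W}`, Haar probability measures on `[U(W_j)]`, `toHG` = "class
of an automorphic function", `Adm_j` = admissible theta data) — a reading claim, audited field by field in
GAPS.md `## pub-hodgecm-pv08-g2` (S5-A1), not a kernel one.  This is the S5 analogue of the carver's S3
boundary witness `SeamVacuity.clusterOutputs_iff_open_chars`.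

Nothing is cited, nothing is posited; Mathlib + landed `HodgeCM.*` + pv11's record only.
-/

set_option autoImplicit false

noncomputable section

open MeasureTheory
open HodgeCM.Prior.Perl34File
open HodgeCM.PerL34.Seesaw

namespace HodgeCM
namespace PerL34
namespace S5Conservative

variable {U : Universe} {T : U.ThetaModel}
variable {L : CMField} {ι₁ : L →+* ℂ} {V : HermSpace3 L ι₁} {c : SeesawCtx L}
variable {D : Perl34.TorusData (T.core V c)} {k l : Fin 4}

/-! ## 1. A one-point lattice shell over an arbitrary carrier `G` with a base point -/

/-- The degenerate shell: `G_U(𝔸) := G`, both adelic tori and both rational index sets are one point, all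
three Schwartz spaces are `G → ℂ`, evaluation at the (unique) rational point is evaluation at the base point
`g₀`, the pure tensor is the pointwise product, and every Weil operator `ω(g,·)` sends `φ` to the constant
function with value `φ g` (so that the "theta kernel" of `φ` is `φ` itself). -/
def shell (G : Type) (g₀ : G) : ThetaSeesawData where
  G := G
  A₁ := Unit
  A₂ := Unit
  X₁ := Unit
  X₂ := Unit
  S₁ := G → ℂ
  S₂ := G → ℂ
  S := G → ℂ
  ev₁ := fun φ _ => φ g₀
  ev₂ := fun φ _ => φ g₀
  ev := fun Φ _ => Φ g₀
  tmul := fun φ₁ φ₂ => φ₁ * φ₂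
  ω₁ := fun g _ φ => fun _ => φ g
  ω₂ := fun g _ φ => fun _ => φ g
  ωW := fun g _ Φ => fun _ => Φ g

variable {G : Type} {g₀ : G}

/-- (Ported verbatim from the HodgeCMPerL package; no docstring in the source.) -/
instance : AddCommGroup (shell G g₀).S := inferInstanceAs (AddCommGroup (G → ℂ))
/-- (Ported verbatim from the HodgeCMPerL package; no docstring in the source.) -/
instance : Fintype (shell G g₀).X₁ := inferInstanceAs (Fintype Unit)
/-- (Ported verbatim from the HodgeCMPerL package; no docstring in the source.) -/
instance : Fintype (shell G g₀).X₂ := inferInstanceAs (Fintype Unit)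
/-- (Ported verbatim from the HodgeCMPerL package; no docstring in the source.) -/
instance : Fintype (shell G g₀).A₁ := inferInstanceAs (Fintype Unit)
/-- (Ported verbatim from the HodgeCMPerL package; no docstring in the source.) -/
instance : Fintype (shell G g₀).A₂ := inferInstanceAs (Fintype Unit)
/-- (Ported verbatim from the HodgeCMPerL package; no docstring in the source.) -/
instance : Unique (shell G g₀).X₁ := inferInstanceAs (Unique Unit)
/-- (Ported verbatim from the HodgeCMPerL package; no docstring in the source.) -/
instance : Unique (shell G g₀).X₂ := inferInstanceAs (Unique Unit)
/-- (Ported verbatim from the HodgeCMPerL package; no docstring in the source.) -/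
instance : Unique (shell G g₀).A₁ := inferInstanceAs (Unique Unit)
/-- (Ported verbatim from the HodgeCMPerL package; no docstring in the source.) -/
instance : Unique (shell G g₀).A₂ := inferInstanceAs (Unique Unit)
/-- (Ported verbatim from the HodgeCMPerL package; no docstring in the source.) -/
instance : MeasurableSpace (shell G g₀).A₁ := inferInstanceAs (MeasurableSpace Unit)
/-- (Ported verbatim from the HodgeCMPerL package; no docstring in the source.) -/
instance : MeasurableSpace (shell G g₀).A₂ := inferInstanceAs (MeasurableSpace Unit)
/-- (Ported verbatim from the HodgeCMPerL package; no docstring in the source.) -/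
instance : MeasurableSingletonClass (shell G g₀).A₁ := inferInstanceAs (MeasurableSingletonClass Unit)
/-- (Ported verbatim from the HodgeCMPerL package; no docstring in the source.) -/
instance : MeasurableSingletonClass (shell G g₀).A₂ := inferInstanceAs (MeasurableSingletonClass Unit)

/-- Dirac measure at the unique point of `[U(W₁)]`. -/
def δ₁ : Measure (shell G g₀).A₁ := Measure.dirac ()
/-- Dirac measure at the unique point of `[U(W₂)]`. -/
def δ₂ : Measure (shell G g₀).A₂ := Measure.dirac ()

/-- (Ported verbatim from the HodgeCMPerL package; no docstring in the source.) -/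
instance : IsProbabilityMeasure (δ₁ (G := G) (g₀ := g₀)) := by unfold δ₁; infer_instance
/-- (Ported verbatim from the HodgeCMPerL package; no docstring in the source.) -/
instance : IsProbabilityMeasure (δ₂ (G := G) (g₀ := g₀)) := by unfold δ₂; infer_instance

/-- (Ported verbatim from the HodgeCMPerL package; no docstring in the source.) -/
theorem shell_omegaSub : (shell G g₀).OmegaSub := by
  intro g t Φ Φ'
  rfl

/-- (Ported verbatim from the HodgeCMPerL package; no docstring in the source.) -/
theorem shell_evSub : (shell G g₀).EvSub := by
  intro Φ Φ' z
  rfl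

/-- (Ported verbatim from the HodgeCMPerL package; no docstring in the source.) -/
theorem shell_evalTmul : (shell G g₀).EvalTmul := by
  intro φ₁ φ₂ z
  rfl

/-- (Ported verbatim from the HodgeCMPerL package; no docstring in the source.) -/
theorem shell_restrictTmul : (shell G g₀).RestrictTmul := by
  intro g u₁ u₂ φ₁ φ₂
  rfl

/-- (Ported verbatim from the HodgeCMPerL package; no docstring in the source.) -/
theorem shell_absSummable₁ : (shell G g₀).AbsSummable₁ := fun _ => Summable.of_finite

/-- (Ported verbatim from the HodgeCMPerL package; no docstring in the source.) -/
theorem shell_absSummable₂ : (shell G g₀).AbsSummable₂ := fun _ => Summable.of_finite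

/-- In the one-point shell the theta kernel of `φ` is `φ`. -/
theorem shell_thetaKernel₁ (φ : G → ℂ) (g : G) (u : Unit) :
    (shell G g₀).thetaKernel₁ φ g u = φ g := by
  simp [ThetaSeesawData.thetaKernel₁, shell, tsum_fintype]

/-- (Ported verbatim from the HodgeCMPerL package; no docstring in the source.) -/
theorem shell_thetaKernel₂ (φ : G → ℂ) (g : G) (u : Unit) :
    (shell G g₀).thetaKernel₂ φ g u = φ g := by
  simp [ThetaSeesawData.thetaKernel₂, shell, tsum_fintype]

/-- … and the theta lift against the trivial character is `φ` as well. -/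
theorem shell_thetaLift₁ (φ : G → ℂ) (g : G) :
    (shell G g₀).thetaLift₁ δ₁ (fun _ => 1) φ g = φ g := by
  simp [ThetaSeesawData.thetaLift₁, shell_thetaKernel₁, δ₁]

/-- (Ported verbatim from the HodgeCMPerL package; no docstring in the source.) -/
theorem shell_thetaLift₂ (φ : G → ℂ) (g : G) :
    (shell G g₀).thetaLift₂ δ₂ (fun _ => 1) φ g = φ g := by
  simp [ThetaSeesawData.thetaLift₂, shell_thetaKernel₂, δ₂]

/-- (Ported verbatim from the HodgeCMPerL package; no docstring in the source.) -/
theorem shell_integrable₁ (χ : Unit → ℂ) (φ : G → ℂ) (g : G) :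
    Integrable (fun u => (shell G g₀).thetaKernel₁ φ g u * χ u) δ₁ := Integrable.of_finite

/-- (Ported verbatim from the HodgeCMPerL package; no docstring in the source.) -/
theorem shell_integrable₂ (χ : Unit → ℂ) (φ : G → ℂ) (g : G) :
    Integrable (fun u => (shell G g₀).thetaKernel₂ φ g u * χ u) δ₂ := Integrable.of_finite

/-! ## 2. Coding vectors of `L²([G_U])` as indicator functions and decoding them by choice -/

open Classical in
/-- The indicator function of `{v}` on the carrier. -/
def code (v : G) : G → ℂ := fun g => if g = v then 1 else 0

/-- (Ported verbatim from the HodgeCMPerL package; no docstring in the source.) -/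
theorem code_apply_self (v : G) : code v v = 1 := by simp [code]

/-- (Ported verbatim from the HodgeCMPerL package; no docstring in the source.) -/
theorem code_injective : Function.Injective (code (G := G)) := by
  intro v w h
  have h1 : code v w = code w w := by rw [h]
  rw [code_apply_self] at h1
  by_contra hne
  have : code v w = 0 := by simp [code, Ne.symm hne]
  rw [this] at h1
  exact zero_ne_one h1

/-! ## 3. The junk bridge from the leaf -/

section Bridge

variable (T V c D k l)

/-- The set of values of the cup pairing on theta forms of types `k`, `l` (the left-hand sides of
`N19w_genIdentity`). -/
def IsΛValue (v : T.HG L ι₁ V) : Prop :=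
  ∃ (Γ : Level V) (ω ω' : U.CohC (U.pms L ι₁ V Γ) 1),
    ω ∈ T.Theta V c k Γ ∧ ω' ∈ T.Theta V c l Γ ∧ v = T.Λ Γ ω ω'

open Classical in
/-- The choice-defined realisation map: an indicator function of a `Λ`-value decodes to that value; anything
else decodes to a fixed generator `D.ϑ χ Φ` if one exists, else to `0`. -/
def toHG (f : T.HG L ι₁ V → ℂ) : T.HG L ι₁ V :=
  if h : ∃ v, IsΛValue T V c k l v ∧ f = code v then h.choose
  else if h' : Nonempty (D.X × T.SK V c) then D.ϑ h'.some.1 h'.some.2 else 0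

variable {T V c D k l}

/-- (Ported verbatim from the HodgeCMPerL package; no docstring in the source.) -/
theorem toHG_code {v : T.HG L ι₁ V} (hv : IsΛValue T V c k l v) : toHG T V c D k l (code v) = v := by
  have h : ∃ w, IsΛValue T V c k l w ∧ code v = code w := ⟨v, hv, rfl⟩
  unfold toHG
  rw [dif_pos h]
  exact (code_injective h.choose_spec.2).symm

/-- Under the leaf, every value of `toHG` is a generator `D.ϑ χ Φ` as soon as some `Λ`-value exists. -/
theorem toHG_isGenerator (hgen : N19w_genIdentity T V c D k l) {v₀ : T.HG L ι₁ V}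
    (hv₀ : IsΛValue T V c k l v₀) (f : T.HG L ι₁ V → ℂ) :
    ∃ χ : D.X, ∃ Φ : T.SK V c, D.ϑ χ Φ = toHG T V c D k l f := by
  obtain ⟨Γ₀, ω₀, ω₀', hω₀, hω₀', rfl⟩ := hv₀
  obtain ⟨χ₀, Φ₀, _⟩ := hgen Γ₀ ω₀ hω₀ ω₀' hω₀'
  unfold toHG
  by_cases h : ∃ v, IsΛValue T V c k l v ∧ f = code v
  · rw [dif_pos h]
    obtain ⟨Γ, ω, ω', hω, hω', hv⟩ := h.choose_spec.1
    obtain ⟨χ, Φ, hΛ⟩ := hgen Γ ω hω ω' hω'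
    exact ⟨χ, Φ, by rw [← hΛ, ← hv]⟩
  · rw [dif_neg h]
    have h' : Nonempty (D.X × T.SK V c) := ⟨(χ₀, Φ₀)⟩
    rw [dif_pos h']
    exact ⟨_, _, rfl⟩

variable (T V c D k l) in
/-- Admissible data on `W₁`: trivial character, and `φ` is `0` or the indicator of a `Λ`-value (the clause
records a witness that some `Λ`-value exists). -/
def Adm₁ (χ : Unit → ℂ) (φ : T.HG L ι₁ V → ℂ) : Prop :=
  χ = (fun _ => 1) ∧ ∃ v, IsΛValue T V c k l v ∧ (φ = (fun _ => 0) ∨ φ = code v)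

/-- Admissible data on `W₂`: trivial character and the constant Schwartz function `1`. -/
def Adm₂ (χ : Unit → ℂ) (φ : G → ℂ) : Prop := χ = (fun _ => 1) ∧ φ = fun _ => 1

/-- **The junk bridge.**  From the leaf `N19w_genIdentity` alone, an instance of pv11's record. -/
def bridge_of_genIdentity (hgen : N19w_genIdentity T V c D k l) : SeesawDictionary.SeesawBridge T V c D k l where
  DS := shell (T.HG L ι₁ V) 0
  ν₁ := δ₁
  ν₂ := δ₂
  omegaSub := shell_omegaSub
  evSub := shell_evSub
  evalTmul := shell_evalTmul
  restrictTmul := shell_restrictTmul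
  absSummable₁ := shell_absSummable₁
  absSummable₂ := shell_absSummable₂
  toHG := toHG T V c D k l
  Adm₁ := Adm₁ T V c k l
  Adm₂ := Adm₂
  integrable₁ := fun χ φ _ g => shell_integrable₁ χ φ g
  integrable₂ := fun χ φ _ g => shell_integrable₂ χ φ g
  Λ_wedge := by
    intro Γ ω hω ω' hω'
    have hv : IsΛValue T V c k l (T.Λ Γ ω ω') := ⟨Γ, ω, ω', hω, hω', rfl⟩
    refine ⟨fun _ => 1, fun _ => 1, code (T.Λ Γ ω ω'), fun _ => 0, fun _ => 1, fun _ => 1,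
      ⟨rfl, _, hv, Or.inr rfl⟩, ⟨rfl, _, hv, Or.inl rfl⟩, ⟨rfl, rfl⟩, ⟨rfl, rfl⟩, ?_⟩
    have hw : (shell (T.HG L ι₁ V) 0).wedgeScalar
        ((shell (T.HG L ι₁ V) 0).thetaLift₁ δ₁ (fun _ => 1) (code (T.Λ Γ ω ω')))
        ((shell (T.HG L ι₁ V) 0).thetaLift₁ δ₁ (fun _ => 1) (fun _ => 0))
        ((shell (T.HG L ι₁ V) 0).thetaLift₂ δ₂ (fun _ => 1) (fun _ => 1))
        ((shell (T.HG L ι₁ V) 0).thetaLift₂ δ₂ (fun _ => 1) (fun _ => 1)) = code (T.Λ Γ ω ω') := by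
      funext g
      rw [ThetaSeesawData.wedgeScalar_apply, shell_thetaLift₁, shell_thetaLift₁,
        shell_thetaLift₂]
      simp
    rw [hw, toHG_code hv]
  ϑ_period := by
    rintro χ₁ χ₂ φ₁₁ φ₁₂ φ₂₁ φ₂₂ ⟨-, v₀, hv₀, -⟩ - - -
    exact toHG_isGenerator hgen hv₀ _

/-- **S5 (12)-half boundary witness:** pv11's bridge record is inhabited iff the leaf holds. -/
theorem nonempty_bridge_iff :
    Nonempty (SeesawDictionary.SeesawBridge T V c D k l) ↔ N19w_genIdentity T V c D k l :=
  ⟨fun ⟨B⟩ => SeesawDictionary.N19w_genIdentity_of_bridge B, fun h => ⟨bridge_of_genIdentity h⟩⟩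

end Bridge

/-- **At the level of the assembly binder** (`AssemblyDict.N19w_wedgeMem_of_bridges`,
`SeesawDictionary.open_thetaGen12_of_bridges`): "a bridge at every good context for the (12) side" is
EQUIVALENT to "the leaf `N19w_genIdentity` at every good context for the (12) side" — the hypothesis traded in
by the carver's `perL_of_dictLeaves` (hbr for h19w) has exactly the strength of the one it replaces. -/
theorem bridges_iff_genIdentity (T : U.ThetaModel) :
    (∀ {L : CMField} {ι₁ : L →+* ℂ} (V : HermSpace3 L ι₁) (c : SeesawCtx L), T.GoodCtx ι₁ c →
        Nonempty (SeesawDictionary.SeesawBridge T V c (T.t12 V c) 0 1)) ↔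
    (∀ {L : CMField} {ι₁ : L →+* ℂ} (V : HermSpace3 L ι₁) (c : SeesawCtx L), T.GoodCtx ι₁ c →
        N19w_genIdentity T V c (T.t12 V c) 0 1) :=
  ⟨fun h _ _ V c hc => nonempty_bridge_iff.mp (h V c hc),
    fun h _ _ V c hc => nonempty_bridge_iff.mpr (h V c hc)⟩

end S5Conservative
end PerL34
end HodgeCM

end
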